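import Summits.QuantumFields.BalabanUV.Beta.EriceRemainderEnclosureHistoryAutonomyComparisonDualContraction
import Summits.QuantumFields.BalabanUV.Beta.EriceRemainderEnclosureHistoryAutonomyAntitoneWitness

/-!
# EriceRemainderEnclosureHistoryAutonomyComparisonDualContractionSharp — (E138f) **THE AGE MOMENT `1` IS THE SHARP COMPARISON THRESHOLD FOR EVERY LEVEL
# PROFILE.**  Converse of (E138b) `le_of_isotone_excess_moment` ∕ (E138e) `le_of_isotone_excess_moment_le_one`: for EVERY finitely supported profile `Λ ≥ 0`
# with **`Σ_{k<K} k·Λ_k > 1`** there is an isotone memory with floor, zeroth moment and LEVEL PROFILE `Λ` (on the whole box `]0,1]^ℕ`), a bounded `B′ ≥ B` with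
# constant (hence isotone) excess, one pin, and box solutions with **`h 1 < h′ 1`** (`exists_violation_of_moment_gt_one`).  Hence, over the class of isotone memories
# with level profile `Λ`, «comparison for every bounded isotone excess» holds for ALL of them **iff `Σ_k k·Λ_k ≤ 1`** — the contraction class of (E138) is cut out
# EXACTLY by the age moment, boundary included ((E138e)), for every profile and not only for (E56a)'s one-age hinge.

THE CONSTRUCTION ((E56a)'s switch-off spread over the ages).  Scale the profile on the ages `k ≥ 1` to `Λ′ = sΛ` with `M′ := Σ_k kΛ′_k = 3m∕(2m+1) ∈ ]1,2[`
(`m = Σ kΛ_k > 1`; `Λ′_0 = 0`, `Λ′ ≤ Λ`, so the memory below has profile `Λ` as well); `A := Σ_k Λ′_k`, excess `ε = 1`, floor `b = K+1`, pin `1`, box `]0,1]`,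
`X := (A + M′)∕(1 + A)` — so that `Σ_k Λ′_k((k+1) − X) = X` and `1 < X < 2`.  The memory `B(w) = b + Σ_{k<K} Λ′_k·max(c_k − 1∕w_k², 0)` with activation LEVELS
`c_k = 1 + (k+1)(b+1)` (§2: isotone, floor `b`, modulus `Σ Λ′_k·2c_k√c_k`, profile `Λ`, bounded).  Unperturbed levels `1; 1 + X + jb (j ≥ 1)`: at row `0` the age-`k`
hinge reads `c_k − η_k`, `η_k = (k+1) − X ∈ [0, K]`, and the hinges contribute `Σ Λ′_kη_k = X` in total; from row `1` on every hinge is off (`η_k ≤ K ≤ b`) (§3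
`levels_rec`).  Perturbed levels `1 + j(b+1)`: the translate's extra `ε = 1` per scale lifts the level read by the age-`k` hinge at row `0` by exactly `(k+1) ≥ η_k + …`
onto its activation level — every hinge is OFF along the whole perturbed orbit (§3 `levels'_rec`).  At scale `1`: `a′_1 = 2 + b < 1 + X + b = a_1` iff `X > 1` iff
`M′ > 1`: **`h 1 < h′ 1`**.

Cell `pub-balaban`, β-function sub-cell, BINDER row D4 «RemainderConst leaves for Bałaban's split» (`HOME/BINDER-OWNERS.md`; owner lineage `b2b-balaban-beta-an4`;
this file by co-owner #2 lineage `b2b-balaban-beta-d4-p2`, generation 106), β-FLOW TEAM duty (1), FREEZE (0) honoured (def-free: functionals and level sequences are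
displayed lambda terms, as in (E49b) ∕ (E56a); node U2's `one_div_sq_one_div_sqrt` and (E45) `…AntitoneWitness.abs_inv_sq_sub_inv_sq_le` BY NAME; the level hinge with a general activation level (§1) generalises (E56a)'s
§1 (`c = 1`) and is proved here, nothing restated).

HONEST FRAMING (page 1, verbatim and binding).  *"Discharging BetaPertH makes Bałaban's UV stability UNCONDITIONAL — a real constructive-QFT result; it is
NOT the continuum limit and NOT the Clay problem."*  THIS FILE DISCHARGES NOTHING OF THE KIND.  Elementary real analysis about DISPLAYED abstract functionals on a box
]0,1]^ℕ — census examples, not facts; nothing about Bałaban's (1.22) limit functional is PRINTED in this form ([I] p. 298; GAPS G-t4-U2-1∕-2) or asserted.  Row D4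
class UNCHANGED (critical-path width 0; instance 0∕1; D4 DISCHARGE NO DATE).  NOT B12 Thm 2, NOT BetaPertH, NOT continuum YM, NOT Clay.

WHAT IS PROVED ([folklore]; 0 `def`, 0 sorry).  §1 `posPart_sub_posPart_le`, `lhinge_eq`, `abs_lhinge_sub_le`, `lhinge_mono`, `lhinge_nonneg`,
`lhinge_le`, `lhinge_sub_le_posPart`.  §2 `mh_floor`, `mh_le`, `mh_isotone`, `mh_zm`, `mh_profile`.  §3 **`levels_rec`**, **`levels'_rec`**.  §4 `scale_moment`,
**`exists_violation_of_moment_gt_one`**.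
-/

noncomputable section
open Finset Set

namespace Summit.QuantumFields.BalabanUV.Beta.EriceRemainderEnclosureHistoryAutonomyComparisonDualContractionSharp

open Literature.MathematicalPhysics.QuantumFieldTheory.Balaban1983to89
open Literature.MathematicalPhysics.QuantumFieldTheory.Balaban1983to89.T4BetaStationary
open Literature.MathematicalPhysics.QuantumFieldTheory.Balaban1983to89.T4BetaFlowWellPosed
open Summit.QuantumFields.BalabanUV.Beta.EriceRemainderEnclosureHistoryAutonomyAntitoneWitness (abs_inv_sq_sub_inv_sq_le)

/-! ## §1 Level hinges with an arbitrary activation level -/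

/-- Positive parts are subadditive, one-sided: `x⁺ − y⁺ ≤ (x − y)⁺`. [folklore] -/
theorem posPart_sub_posPart_le (x y : ℝ) : max x 0 - max y 0 ≤ max (x - y) 0 := by
  rcases le_or_gt 0 x with hx | hx
  · rw [max_eq_left hx]
    rcases le_or_gt 0 y with hy | hy
    · rw [max_eq_left hy]; exact le_max_left _ _
    · rw [max_eq_right hy.le, max_eq_left (by linarith)]; linarith
  · rw [max_eq_right hx.le]; linarith [le_max_right y 0, le_max_right (x - y) 0]

/-- THE LEVEL HINGE `y ↦ max(c − 1∕y², 0)` (`c > 0`: OFF while the level `1∕y²` is above the activation level `c`, i.e. the coupling below `1∕√c`) is the clipped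
inverse square: `max(c − 1∕y², 0) = c − 1∕max(y, 1∕√c)²` for `y > 0`. [folklore] -/
theorem lhinge_eq {c y : ℝ} (hc : 0 < c) (hy : 0 < y) : max (c - 1 / y ^ 2) 0 = c - 1 / (max y (1 / Real.sqrt c)) ^ 2 := by
  have hr : 0 < 1 / Real.sqrt c := by positivity
  have hr2 : (1 / Real.sqrt c) ^ 2 = 1 / c := by rw [div_pow, one_pow, Real.sq_sqrt hc.le]
  rcases le_or_gt y (1 / Real.sqrt c) with hle | hlt
  · rw [max_eq_right hle, hr2, one_div_one_div, sub_self, max_eq_right]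
    rw [sub_nonpos]
    calc c = 1 / (1 / Real.sqrt c) ^ 2 := by rw [hr2, one_div_one_div]
      _ ≤ 1 / y ^ 2 := one_div_le_one_div_of_le (pow_pos hy 2) (pow_le_pow_left₀ hy.le hle 2)
  · rw [max_eq_left hlt.le, max_eq_left]
    rw [sub_nonneg]
    calc 1 / y ^ 2 ≤ 1 / (1 / Real.sqrt c) ^ 2 := one_div_le_one_div_of_le (pow_pos hr 2) (pow_le_pow_left₀ hr.le hlt.le 2)
      _ = c := by rw [hr2, one_div_one_div]

/-- THE LEVEL HINGE IS LIPSCHITZ IN THE COUPLING: `|max(c − 1∕y², 0) − max(c − 1∕y′², 0)| ≤ 2c√c·|y − y′|` for `y, y′ > 0` — slope at most `2∕r³ = 2c^{3∕2}`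
above the activation coupling `r = 1∕√c`, zero below. [folklore] -/
theorem abs_lhinge_sub_le {c y y' : ℝ} (hc : 0 < c) (hy : 0 < y) (hy' : 0 < y') :
    |max (c - 1 / y ^ 2) 0 - max (c - 1 / y' ^ 2) 0| ≤ 2 * c * Real.sqrt c * |y - y'| := by
  have hr : 0 < 1 / Real.sqrt c := by positivity
  rw [lhinge_eq hc hy, lhinge_eq hc hy', show c - 1 / max y (1 / Real.sqrt c) ^ 2 - (c - 1 / max y' (1 / Real.sqrt c) ^ 2)
    = 1 / max y' (1 / Real.sqrt c) ^ 2 - 1 / max y (1 / Real.sqrt c) ^ 2 by ring]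
  have hr3 : 2 / (1 / Real.sqrt c) ^ 3 = 2 * c * Real.sqrt c := by
    have hs : 0 < Real.sqrt c := Real.sqrt_pos.mpr hc
    rw [div_pow, one_pow, div_div_eq_mul_div, div_one, pow_succ, Real.sq_sqrt hc.le]; ring
  have h1 := abs_inv_sq_sub_inv_sq_le hr (le_max_right y' _) (le_max_right y _)
  rw [hr3] at h1
  have h2 : |max y' (1 / Real.sqrt c) - max y (1 / Real.sqrt c)| ≤ |y - y'| := by
    rw [abs_sub_comm y y']; exact abs_max_sub_max_le_abs _ _ _
  exact h1.trans (mul_le_mul_of_nonneg_left h2 (by positivity))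

/-- The level hinge is non-decreasing in the coupling. [folklore] -/
theorem lhinge_mono {c y y' : ℝ} (hy : 0 < y) (hyy' : y ≤ y') : max (c - 1 / y ^ 2) 0 ≤ max (c - 1 / y' ^ 2) 0 :=
  max_le_max (by linarith [one_div_le_one_div_of_le (pow_pos hy 2) (pow_le_pow_left₀ hy.le hyy' 2)]) le_rfl

/-- … non-negative … [folklore] -/
theorem lhinge_nonneg (c y : ℝ) : 0 ≤ max (c - 1 / y ^ 2) 0 := le_max_right _ _

/-- … at most `c` (`c ≥ 0`) … [folklore] -/
theorem lhinge_le {c : ℝ} (hc : 0 ≤ c) (y : ℝ) : max (c - 1 / y ^ 2) 0 ≤ c :=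
  max_le (by linarith [(by positivity : 0 ≤ 1 / y ^ 2)]) hc

/-- … and ONE-SIDED `1`-LIPSCHITZ ANTITONE IN THE LEVEL: `max(c − 1∕u², 0) − max(c − 1∕v², 0) ≤ (1∕v² − 1∕u²)⁺`. [folklore] -/
theorem lhinge_sub_le_posPart (c u v : ℝ) : max (c - 1 / u ^ 2) 0 - max (c - 1 / v ^ 2) 0 ≤ max (1 / v ^ 2 - 1 / u ^ 2) 0 := by
  have := posPart_sub_posPart_le (c - 1 / u ^ 2) (c - 1 / v ^ 2)
  rwa [show c - 1 / u ^ 2 - (c - 1 / v ^ 2) = 1 / v ^ 2 - 1 / u ^ 2 by ring] at this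


/-! ## §2 The multi-hinge memory `b + Σ_{k<K} Λ′_k·max(c_k − 1∕w_k², 0)` on the box `]0,1]^ℕ` -/

variable {Λ Λ' c a a' : ℕ → ℝ} {K : ℕ} {b X : ℝ}

/-- The multi-hinge memory has floor `b` (`Λ′ ≥ 0`) … [folklore] -/
theorem mh_floor (hΛ' : ∀ k, 0 ≤ Λ' k) (w : ℕ → ℝ) :
    b ≤ (fun w : ℕ → ℝ => b + ∑ k ∈ range K, Λ' k * max (c k - 1 / w k ^ 2) 0) w := by
  have : 0 ≤ ∑ k ∈ range K, Λ' k * max (c k - 1 / w k ^ 2) 0 := sum_nonneg fun k _ => mul_nonneg (hΛ' k) (lhinge_nonneg _ _)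
  simp only; linarith

/-- … is bounded by `b + Σ_k Λ′_k c_k` (`c ≥ 0`) … [folklore] -/
theorem mh_le (hΛ' : ∀ k, 0 ≤ Λ' k) (hc : ∀ k, 0 ≤ c k) (w : ℕ → ℝ) :
    (fun w : ℕ → ℝ => b + ∑ k ∈ range K, Λ' k * max (c k - 1 / w k ^ 2) 0) w ≤ b + ∑ k ∈ range K, Λ' k * c k := by
  have := sum_le_sum (s := range K) fun k _ => mul_le_mul_of_nonneg_left (lhinge_le (hc k) (w k)) (hΛ' k)
  simp only; linarith

/-- … is ISOTONE on the box … [folklore] -/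
theorem mh_isotone (hΛ' : ∀ k, 0 ≤ Λ' k) : ∀ u v : ℕ → ℝ, SeqBox 1 u → SeqBox 1 v → (∀ j, u j ≤ v j) →
    (fun w : ℕ → ℝ => b + ∑ k ∈ range K, Λ' k * max (c k - 1 / w k ^ 2) 0) u
      ≤ (fun w : ℕ → ℝ => b + ∑ k ∈ range K, Λ' k * max (c k - 1 / w k ^ 2) 0) v := by
  intro u v hu _ huv
  have := sum_le_sum (s := range K) fun k _ => mul_le_mul_of_nonneg_left (lhinge_mono (c := c k) (hu k).1 (huv k)) (hΛ' k)
  simp only; linarith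

/-- … has ZEROTH MOMENT `Σ_k Λ′_k·2c_k√c_k` on the box (`c > 0`) … [folklore] -/
theorem mh_zm (hΛ' : ∀ k, 0 ≤ Λ' k) (hc : ∀ k, 0 < c k) : ∀ u u' : ℕ → ℝ, SeqBox 1 u → SeqBox 1 u' → ∀ D : ℝ, (∀ j, |u j - u' j| ≤ D) →
    |(fun w : ℕ → ℝ => b + ∑ k ∈ range K, Λ' k * max (c k - 1 / w k ^ 2) 0) u
      - (fun w : ℕ → ℝ => b + ∑ k ∈ range K, Λ' k * max (c k - 1 / w k ^ 2) 0) u'|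
      ≤ (∑ k ∈ range K, Λ' k * (2 * c k * Real.sqrt (c k))) * D := by
  intro u u' hu hu' D hD
  simp only
  rw [show b + ∑ k ∈ range K, Λ' k * max (c k - 1 / u k ^ 2) 0 - (b + ∑ k ∈ range K, Λ' k * max (c k - 1 / u' k ^ 2) 0)
      = ∑ k ∈ range K, Λ' k * (max (c k - 1 / u k ^ 2) 0 - max (c k - 1 / u' k ^ 2) 0) by
    rw [add_sub_add_left_eq_sub, ← sum_sub_distrib]; exact sum_congr rfl fun k _ => by ring]
  refine (abs_sum_le_sum_abs _ _).trans ?_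
  rw [sum_mul]
  refine sum_le_sum fun k _ => ?_
  rw [abs_mul, abs_of_nonneg (hΛ' k), mul_assoc]
  refine mul_le_mul_of_nonneg_left ?_ (hΛ' k)
  exact (abs_lhinge_sub_le (hc k) (hu k).1 (hu' k).1).trans (mul_le_mul_of_nonneg_left (hD k) (by have := hc k; positivity))

/-- … and carries every LEVEL PROFILE `Λ ≥ Λ′`: `B u − B v ≤ Σ_k Λ_k·(1∕v_k² − 1∕u_k²)⁺` for all configurations (one-sided `1`-Lipschitz antitone hinges). [folklore] -/
theorem mh_profile (hΛ' : ∀ k, 0 ≤ Λ' k) (hΛ'Λ : ∀ k, Λ' k ≤ Λ k) (u v : ℕ → ℝ) :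
    (fun w : ℕ → ℝ => b + ∑ k ∈ range K, Λ' k * max (c k - 1 / w k ^ 2) 0) u
      - (fun w : ℕ → ℝ => b + ∑ k ∈ range K, Λ' k * max (c k - 1 / w k ^ 2) 0) v
      ≤ ∑ k ∈ range K, Λ k * max (1 / v k ^ 2 - 1 / u k ^ 2) 0 := by
  simp only
  rw [show b + ∑ k ∈ range K, Λ' k * max (c k - 1 / u k ^ 2) 0 - (b + ∑ k ∈ range K, Λ' k * max (c k - 1 / v k ^ 2) 0)
      = ∑ k ∈ range K, Λ' k * (max (c k - 1 / u k ^ 2) 0 - max (c k - 1 / v k ^ 2) 0) by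
    rw [add_sub_add_left_eq_sub, ← sum_sub_distrib]; exact sum_congr rfl fun k _ => by ring]
  refine sum_le_sum fun k _ => ?_
  calc Λ' k * (max (c k - 1 / u k ^ 2) 0 - max (c k - 1 / v k ^ 2) 0)
      ≤ Λ' k * max (1 / v k ^ 2 - 1 / u k ^ 2) 0 := mul_le_mul_of_nonneg_left (lhinge_sub_le_posPart _ _ _) (hΛ' k)
    _ ≤ Λ k * max (1 / v k ^ 2 - 1 / u k ^ 2) 0 := mul_le_mul_of_nonneg_right (hΛ'Λ k) (le_max_right _ _)

/-! ## §3 The two explicit level sequences -/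

/-- **THE UNPERTURBED LEVELS** `1; 1 + X + b, 1 + X + 2b, …` solve the flow of the multi-hinge memory with activation levels `c_k = 1 + (k+1)(b+1)`: at row `0`
the hinge of age `k` reads the level `1 + X + (k+1)b = c_k − η_k`, `η_k = (k+1) − X`, and contributes `Λ′_k η_k` (the FIXED-POINT identity `Σ_k Λ′_k η_k = X`,
with `η_k ≥ 0` wherever `Λ′_k ≠ 0`); at every later row all hinges are OFF (`η_k ≤ K ≤ b`). [folklore] -/
theorem levels_rec (hc : ∀ k, c k = 1 + ((k : ℝ) + 1) * (b + 1)) (ha0 : a 0 = 1) (haS : ∀ j : ℕ, a (j + 1) = 1 + X + ((j : ℝ) + 1) * b)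
    (hfix : ∑ k ∈ range K, Λ' k * (((k : ℝ) + 1) - X) = X) (hη : ∀ k, k < K → Λ' k = 0 ∨ X ≤ (k : ℝ) + 1) (hX0 : 0 ≤ X)
    (hb : 0 ≤ b) (hKb : (K : ℝ) ≤ b) (m : ℕ) :
    a (m + 1) = a m + (b + ∑ k ∈ range K, Λ' k * max (c k - a (m + 1 + k)) 0) := by
  rcases m with _ | n
  · have e : ∀ k ∈ range K, Λ' k * max (c k - a (0 + 1 + k)) 0 = Λ' k * (((k : ℝ) + 1) - X) := by
      intro k hk
      rw [show 0 + 1 + k = k + 1 by omega, haS, hc]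
      rcases hη k (mem_range.mp hk) with h0 | hle
      · rw [h0, zero_mul, zero_mul]
      · rw [max_eq_left (by nlinarith)]; ring
    rw [sum_congr rfl e, hfix, show (0 : ℕ) + 1 = 1 from rfl, show (1 : ℕ) = 0 + 1 from rfl, haS, ha0]
    push_cast; ring
  · have e : ∀ k ∈ range K, Λ' k * max (c k - a (n + 1 + 1 + k)) 0 = 0 := by
      intro k hk
      have hk' : (k : ℝ) + 1 ≤ K := by exact_mod_cast mem_range.mp hk
      rw [show n + 1 + 1 + k = (n + 1 + k) + 1 by omega, haS, hc, max_eq_right, mul_zero]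
      have hn : (0 : ℝ) ≤ n := Nat.cast_nonneg n
      push_cast; nlinarith
    rw [sum_congr rfl e, sum_const_zero, haS, haS]
    push_cast; ring

/-- **THE PERTURBED LEVELS** `1 + j(b+1)` solve the flow of the TRANSLATE by the constant excess `1`: every hinge reads a level `≥` its activation level and is OFF.
[folklore] -/
theorem levels'_rec (hc : ∀ k, c k = 1 + ((k : ℝ) + 1) * (b + 1)) (ha' : ∀ j : ℕ, a' j = 1 + (j : ℝ) * (b + 1)) (hb : 0 ≤ b) (m : ℕ) :
    a' (m + 1) = a' m + (b + ∑ k ∈ range K, Λ' k * max (c k - a' (m + 1 + k)) 0 + 1) := by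
  have e : ∀ k ∈ range K, Λ' k * max (c k - a' (m + 1 + k)) 0 = 0 := by
    intro k _
    rw [ha', hc, max_eq_right, mul_zero]
    have hm : (0 : ℝ) ≤ m := Nat.cast_nonneg m
    push_cast; nlinarith
  rw [sum_congr rfl e, sum_const_zero, ha', ha']
  push_cast; ring

/-! ## §4 The moment threshold is sharp for every profile -/

/-- The scaling `s = 3∕(2m+1)` of a moment `m > 1`: `0 < s ≤ 1` and `1 < s·m < 2`. [folklore] -/
theorem scale_moment {m : ℝ} (hm : 1 < m) :
    0 < 3 / (2 * m + 1) ∧ 3 / (2 * m + 1) ≤ 1 ∧ 1 < 3 / (2 * m + 1) * m ∧ 3 / (2 * m + 1) * m < 2 := by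
  have h0 : 0 < 2 * m + 1 := by linarith
  refine ⟨by positivity, ?_, ?_, ?_⟩
  · rw [div_le_one h0]; linarith
  · rw [div_mul_eq_mul_div, lt_div_iff₀ h0]; linarith
  · rw [div_mul_eq_mul_div, div_lt_iff₀ h0]; linarith

/-- **THE AGE MOMENT `1` IS THE SHARP COMPARISON THRESHOLD FOR EVERY LEVEL PROFILE.**  For EVERY finitely supported profile `Λ ≥ 0` with `Σ_{k<K} k·Λ_k > 1` there
are a box `]0,γ]` (`γ = 1`), an ISOTONE memory `B` with floor `b > 0`, a zeroth moment, and LEVEL PROFILE `Λ` on the whole box (a fortiori on the graded box), a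
functional `B′ ≥ B`, bounded, with ISOTONE (indeed constant) excess, one pin, and box solutions `h` of `B`, `h′` of `B′` with **`h 1 < h′ 1`** — every hypothesis of
(E138b) `le_of_isotone_excess_moment` ∕ (E138e) `le_of_isotone_excess_moment_le_one` except the moment condition, and the conclusion FAILS.  Construction: the
multi-hinge memory `b + Σ_{k≥1} Λ′_k·max(c_k − 1∕w_k², 0)` with `Λ′ = sΛ` on the ages `≥ 1`, `s·Σ kΛ_k ∈ ]1,2[`, `b = K+1`, `c_k = 1 + (k+1)(b+1)`, excess `ε = 1`,
`X = (Σ_kΛ′_k + Σ_k kΛ′_k)∕(1 + Σ_kΛ′_k) > 1 = ε` (§3): one combined switch-off at the top, exactly (E56a)'s mechanism spread over the ages.  With (E138e): over the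
isotone memories of level profile `Λ`, comparison for all bounded isotone excesses holds for all of them **iff `Σ_k k·Λ_k ≤ 1`**. [folklore] -/
theorem exists_violation_of_moment_gt_one {K : ℕ} {Λ : ℕ → ℝ} (hΛ : ∀ k, 0 ≤ Λ k) (hgt : 1 < ∑ k ∈ range K, (k : ℝ) * Λ k) :
    ∃ (γ b M βb : ℝ) (B B' : (ℕ → ℝ) → ℝ) (p : ℝ) (h h' : ℕ → ℝ),
      (∀ u v : ℕ → ℝ, SeqBox γ u → SeqBox γ v → (∀ i, u i ≤ v i) → B u ≤ B v) ∧
      (∀ u u' : ℕ → ℝ, SeqBox γ u → SeqBox γ u' → ∀ D : ℝ, (∀ j, |u j - u' j| ≤ D) → |B u - B u'| ≤ M * D) ∧ 0 ≤ M ∧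
      0 < b ∧ (∀ u, SeqBox γ u → b ≤ B u) ∧
      (∀ u v : ℕ → ℝ, SeqBox γ u → SeqBox γ v → (∀ k : ℕ, 1 / γ ^ 2 + ((k : ℝ) + 1) * b ≤ 1 / u k ^ 2) →
        (∀ k : ℕ, 1 / γ ^ 2 + ((k : ℝ) + 1) * b ≤ 1 / v k ^ 2) → B u - B v ≤ ∑ k ∈ range K, Λ k * max (1 / v k ^ 2 - 1 / u k ^ 2) 0) ∧
      (∀ u, SeqBox γ u → B u ≤ B' u) ∧ (∀ u, SeqBox γ u → B' u ≤ βb) ∧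
      (∀ u v : ℕ → ℝ, SeqBox γ u → SeqBox γ v → (∀ i, u i ≤ v i) → B' u - B u ≤ B' v - B v) ∧
      0 < p ∧ p ≤ γ ∧ SeqBox γ h ∧ MemFlow B p h ∧ SeqBox γ h' ∧ MemFlow B' p h' ∧ h 1 < h' 1 := by
  -- the scaled profile on the ages ≥ 1
  set m : ℝ := ∑ k ∈ range K, (k : ℝ) * Λ k with hm
  obtain ⟨hs0, hs1, hsm1, hsm2⟩ := scale_moment hgt
  set s : ℝ := 3 / (2 * m + 1) with hs
  set Λ' : ℕ → ℝ := fun k => if k = 0 then 0 else s * Λ k with hΛ'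
  have hΛ'0 : ∀ k, 0 ≤ Λ' k := fun k => by
    simp only [hΛ']; split_ifs
    · exact le_rfl
    · exact mul_nonneg hs0.le (hΛ k)
  have hΛ'Λ : ∀ k, Λ' k ≤ Λ k := fun k => by
    simp only [hΛ']; split_ifs
    · exact hΛ k
    · nlinarith [hΛ k]
  have hM' : ∑ k ∈ range K, ((k : ℝ) + 1) * Λ' k = ∑ k ∈ range K, Λ' k + s * m := by
    rw [hm, mul_sum, ← sum_add_distrib]
    refine sum_congr rfl fun k _ => ?_
    simp only [hΛ']; split_ifs with hk
    · subst hk; simp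
    · ring
  set A : ℝ := ∑ k ∈ range K, Λ' k with hA
  have hA0 : 0 ≤ A := sum_nonneg fun k _ => hΛ'0 k
  -- the combined level X switched off by the translate, and the floor
  set X : ℝ := (A + s * m) / (1 + A) with hX
  have h1A : 0 < 1 + A := by linarith
  have hX1 : 1 < X := by rw [hX, lt_div_iff₀ h1A]; linarith
  have hX2 : X < 2 := by rw [hX, div_lt_iff₀ h1A]; linarith
  have hX0 : 0 ≤ X := by linarith
  have hfix : ∑ k ∈ range K, Λ' k * (((k : ℝ) + 1) - X) = X := by
    have e : ∑ k ∈ range K, Λ' k * (((k : ℝ) + 1) - X) = ∑ k ∈ range K, ((k : ℝ) + 1) * Λ' k - X * A := by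
      rw [hA, mul_sum, ← sum_sub_distrib]; exact sum_congr rfl fun k _ => by ring
    rw [e, hM']
    have : X * (1 + A) = A + s * m := by rw [hX]; field_simp
    linarith
  have hη : ∀ k, k < K → Λ' k = 0 ∨ X ≤ (k : ℝ) + 1 := by
    intro k _
    rcases Nat.eq_zero_or_pos k with hk | hk
    · left; simp [hΛ', hk]
    · right
      have : (1 : ℝ) ≤ k := by exact_mod_cast hk
      linarith
  set b : ℝ := (K : ℝ) + 1 with hb
  have hb0 : 0 < b := by positivity
  have hKb : (K : ℝ) ≤ b := by linarith
  -- activation levels, the two functionals, the two level sequences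
  set c : ℕ → ℝ := fun k => 1 + ((k : ℝ) + 1) * (b + 1) with hc
  have hc_eq : ∀ k, c k = 1 + ((k : ℝ) + 1) * (b + 1) := fun k => rfl
  have hc_pos : ∀ k, 0 < c k := fun k => by rw [hc_eq]; positivity
  set a : ℕ → ℝ := fun j => if j = 0 then 1 else 1 + X + (j : ℝ) * b with ha
  have ha0 : a 0 = 1 := by simp [ha]
  have haS : ∀ j : ℕ, a (j + 1) = 1 + X + ((j : ℝ) + 1) * b := fun j => by
    simp only [ha, Nat.succ_ne_zero, if_false]; push_cast; ring
  have ha1 : ∀ j, 1 ≤ a j := by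
    intro j; rcases j with _ | j
    · rw [ha0]
    · rw [haS]; nlinarith
  set a' : ℕ → ℝ := fun j => 1 + (j : ℝ) * (b + 1) with ha'
  have ha'_eq : ∀ j : ℕ, a' j = 1 + (j : ℝ) * (b + 1) := fun j => rfl
  have ha'1 : ∀ j, 1 ≤ a' j := fun j => by rw [ha'_eq]; nlinarith [Nat.cast_nonneg (α := ℝ) j]
  have hrec := levels_rec (Λ' := Λ') (K := K) hc_eq ha0 haS hfix hη hX0 hb0.le hKb
  have hrec' := levels'_rec (Λ' := Λ') (K := K) hc_eq ha'_eq hb0.le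
  -- the functionals
  refine ⟨1, b, ∑ k ∈ range K, Λ' k * (2 * c k * Real.sqrt (c k)), b + ∑ k ∈ range K, Λ' k * c k + 1,
    fun w => b + ∑ k ∈ range K, Λ' k * max (c k - 1 / w k ^ 2) 0,
    fun w => (b + ∑ k ∈ range K, Λ' k * max (c k - 1 / w k ^ 2) 0) + 1,
    1, fun j => 1 / Real.sqrt (a j), fun j => 1 / Real.sqrt (a' j),
    mh_isotone hΛ'0, mh_zm hΛ'0 hc_pos, sum_nonneg fun k _ => mul_nonneg (hΛ'0 k) (by have := hc_pos k; positivity),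
    hb0, fun u _ => mh_floor hΛ'0 u, fun u v _ _ _ _ => mh_profile hΛ'0 hΛ'Λ u v,
    fun u _ => by simp only; linarith, fun u _ => by linarith [mh_le (b := b) (K := K) hΛ'0 (fun k => (hc_pos k).le) u],
    fun u v _ _ _ => by simp only; linarith, one_pos, le_rfl, ?_, ?_, ?_, ?_, ?_⟩
  · -- h in the box ]0,1]
    intro j
    have hpos : 0 < Real.sqrt (a j) := Real.sqrt_pos.mpr (by linarith [ha1 j])
    refine ⟨by positivity, ?_⟩
    rw [div_le_one hpos]
    calc (1 : ℝ) = Real.sqrt 1 := Real.sqrt_one.symm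
      _ ≤ Real.sqrt (a j) := Real.sqrt_le_sqrt (ha1 j)
  · -- h solves the flow of B from the pin 1
    refine ⟨by simp only [ha0, Real.sqrt_one, div_one], fun n => ?_⟩
    simp only
    rw [one_div_sq_one_div_sqrt (by linarith [ha1 (n + 1)]), one_div_sq_one_div_sqrt (by linarith [ha1 n])]
    have e : ∀ k ∈ range K, Λ' k * max (c k - 1 / (1 / Real.sqrt (a (n + 1 + k))) ^ 2) 0 = Λ' k * max (c k - a (n + 1 + k)) 0 := by
      intro k _; rw [one_div_sq_one_div_sqrt (by linarith [ha1 (n + 1 + k)])]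
    rw [sum_congr rfl e]
    exact hrec n
  · -- h′ in the box
    intro j
    have hpos : 0 < Real.sqrt (a' j) := Real.sqrt_pos.mpr (by linarith [ha'1 j])
    refine ⟨by positivity, ?_⟩
    rw [div_le_one hpos]
    calc (1 : ℝ) = Real.sqrt 1 := Real.sqrt_one.symm
      _ ≤ Real.sqrt (a' j) := Real.sqrt_le_sqrt (ha'1 j)
  · -- h′ solves the flow of B′ = B + 1 from the pin 1
    refine ⟨by simp only [ha'_eq, Nat.cast_zero, zero_mul, add_zero, Real.sqrt_one, div_one], fun n => ?_⟩
    simp only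
    rw [one_div_sq_one_div_sqrt (by linarith [ha'1 (n + 1)]), one_div_sq_one_div_sqrt (by linarith [ha'1 n])]
    have e : ∀ k ∈ range K, Λ' k * max (c k - 1 / (1 / Real.sqrt (a' (n + 1 + k))) ^ 2) 0 = Λ' k * max (c k - a' (n + 1 + k)) 0 := by
      intro k _; rw [one_div_sq_one_div_sqrt (by linarith [ha'1 (n + 1 + k)])]
    rw [sum_congr rfl e]
    exact hrec' n
  · -- the violation at scale 1: a′ 1 = 2 + b < 1 + X + b = a 1
    simp only
    have hlt : a' 1 < a 1 := by rw [ha'_eq, show (1 : ℕ) = 0 + 1 from rfl, haS]; push_cast; linarith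
    have hpos' : 0 < a' 1 := by linarith [ha'1 1]
    exact one_div_lt_one_div_of_lt (Real.sqrt_pos.mpr hpos') (Real.sqrt_lt_sqrt hpos'.le hlt)

end Summit.QuantumFields.BalabanUV.Beta.EriceRemainderEnclosureHistoryAutonomyComparisonDualContractionSharp

end
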